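import Summits.CriticalPhenomena.PercolationContinuityZ3.Theses.PercTiltedBlockers
import Summits.CriticalPhenomena.PercolationContinuityZ3.Theorems.PercTiltedBlockersTiltComparisonStubBoxMono
import Summits.CriticalPhenomena.PercolationContinuityZ3.Theorems.PercTiltedBlockersTiltComparisonStubDiagReduce

/-!
# Line `birth` — registered skeleton for the crux `TiltComparison`
# (stmt-CriticalPhenomena-6393, route `PercTiltedBlockers`, rank 2)

Crux (fixed, by name): `PercTiltedBlockers.TiltComparison` — at `p = p_c(ℤ³)`, for the boxes
`R = R(4m; L, M) = Icc 0 (4m, L, M)` of `ℤ³` with `m ≥ 1`, `L, M ∈ [4m, 24m]`, there is a level `a`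
with `g(P(Blocked R)) ≤ P(Tilt_a R)` for ONE monotone `g`, `g > 0` on `(0, ∞)`, where
`Blocked R` = no open path inside `R` from the face `x₀ = 0` to the face `x₀ = 4m`, and
`Tilt_a R` = no open path inside `R` from `Src_a = {x₀ = 0} ∪ {x₁ = L, x₀ < a}` to
`Tgt_a = {x₀ = 4m} ∪ {x₁ = m, x₀ ≥ a}`.

THE LINE (the route's own TWO-LAYER PLAN for this node, "TiltComparison ⇐ TiltBalancing →
TiltMerging", with the merging step made explicit by Harris–FKG). Writing the four electrode
pieces `B = {x₀ = 0}` (bottom), `RL_a = {x₁ = L, x₀ < a}` (low right patch), `T = {x₀ = 4m}` (top),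
`MH_a = {x₁ = m, x₀ ≥ a}` (high part of the cross-section plane), the tilt event factors EXACTLY as
an intersection of three decreasing events

  `Tilt_a = High_a ∩ Low_a ∩ Diag_a`,
  `High_a := no open path in R from B ∪ RL_a to T` (a blocker meeting the right face above `a`),
  `Low_a  := no open path in R from B to T ∪ MH_a` (a blocker meeting the plane `x₁ = m` below `a`),
  `Diag_a := no open path in R from RL_a to MH_a` (no tilted crossing of the slab `m ≤ x₁ ≤ L`),

(pure logic on the endpoint predicates: `(P₁ ∨ P₂) ∧ (Q₁ ∨ Q₂)` splits into the four cases, of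
which `High` covers `(P₁ ∨ P₂) ∧ Q₁`, `Low` covers `P₁ ∧ Q₂`, `Diag` covers `P₂ ∧ Q₂`), so by Harris–FKG
for decreasing events (`harris_fkg_lower`, PROVED in tree) `P(Tilt_a) ≥ P(High_a) P(Low_a) P(Diag_a)`.
Hence the crux follows from two single-box comparison statements, the registered stubs:

* `stub_balancing` (OPEN, the hardest stub; = `TiltBalancing` of the two-layer plan, Tassion's
  L2.1 shape): ONE monotone `g₁ > 0` on `(0,∞)` and, for every box of the family, a COMMON level `a`
  at which both one-sided events have probability `≥ g₁(P(Blocked R))`. `a ↦ P(High_a)` decreases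
  from `P(Blocked)` (`a = 0`), `a ↦ P(Low_a)` increases to `P(Blocked)` (`a = 4m+1`); the content is
  that the two ranges overlap at a level where neither has collapsed. Planar analogue: Tassion 2016
  L2.1 (arXiv:1410.6773 pp.6–8), where pigeonhole over landing POINTS + symmetry does it; in `d = 3`
  the electrodes are LINES/patches and no pigeonhole is available (why it might fail, verbatim from
  the crux: the bottom cluster of a blocked critical box may wet the plane `x₁ = m` to height
  `4m − o(m)` while the low right patch reaches the top).
* `stub_diagonal` (= the Harris-explicit form of `TiltMerging`): ONE monotone `g₂ > 0` on `(0,∞)`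
  with `P(Diag_a) ≥ g₂(P(Blocked R))` for EVERY level `a`. Structure (for the prover): an open path
  in `R` from `RL_a` (`x₁ = L`) to `MH_a` (`x₁ = m`) contains a sub-path crossing the slab
  `[0,4m] × [m, L] × [0,M]` in the `x₁`-direction; for `L ≥ 5m` the sub-slab `[m, 5m]` is crossed,
  and by the lattice isometry `x₀ ↔ x₁` (+ translation) and sub-box monotonicity
  `P(Diag_a) ≥ P(Blocked R(4m; 4m, M)) ≥ P(Blocked R(4m; L, M))`, i.e. `g₂ = id` works — provable
  now; for `L ∈ [4m, 5m)` the slab has thickness `L − m ∈ [3m, 4m)` and the stub asks the genuine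
  short-box comparison `P(Blocked R(L−m; 4m, M)) ≥ g₂(P(Blocked R(4m; L, M)))` (aspect-ratio change
  `≥ 3/4` in the blocked direction) — an RSW-type statement, open in `d = 3` but far weaker in
  form than plaquette-RSW (BenjaminiKalai2018 p.71).
* `TiltComparison_of : Stubs.stub_balancing → Stubs.stub_diagonal → TiltComparison` (the stub
  `Prop`s BY NAME; conclusion the route decl BY NAME), PROVED here (no `sorry`): with
  `g s := (max (g₁ s) 0)² · max (g₂ s) 0` (monotone as a product of nonnegative monotone functions,
  `> 0` on `(0,∞)`), at the level `a` of stub 1, `g(P(Blocked)) ≤ P(High_a) P(Low_a) P(Diag_a)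
  ≤ P(High_a ∩ Low_a) P(Diag_a) ≤ P(High_a ∩ Low_a ∩ Diag_a) ≤ P(Tilt_a)` (Harris twice, events
  decreasing and measurable as complements of `openCrossing` events of the finite box, then
  monotonicity of measure along `High ∩ Low ∩ Diag ⊆ Tilt`).
* `TiltComparison_proof : TiltComparison := TiltComparison_of stub_balancing (stub_diagonal_of
  stub_diagReduce stub_boxMono stub_shortbox)` — the skeleton IS the crux proof once the sorries
  are discharged.

RESHAPE (lead prover-line-stmt-CriticalPhenomena-6393-0, cycle 1, 2026-08-17). `stub_diagonal`
is no longer a registered stub but a DERIVED intermediate: `stub_diagonal_of` (PROVED here, pure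
order arithmetic) obtains it with `g₂ s := min s (g_sb s)` from three registered stubs —

* `stub_diagReduce` (provable now, every `p`): `P_p(Blocked R(L−m; 4m, M)) ≤ P_p(Diag_a R(4m;L,M))`
  for all `a` and `m ≤ L` — clip an open `RL_a → MH_a` path at its first visit to the plane
  `x₁ = m` (`exists_openConnIn_le_level` with `f = −x₁`), it lies in `[0,4m] × [m,L] × [0,M]`;
  transport by the lattice isometry `(x₀,x₁,x₂) ↦ (x₁ − m, x₀, x₂)` (`zdSignedPermIso (swap 0 1) 1`
  then `zdShiftIso`), `StubSixSlab.real_compl_openCrossing_image`, `real_mono_of_forall_subset_edgeSet`;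
* `stub_boxMono` (provable now, every `p`): `P_p(Blocked R(h; L, M)) ≤ P_p(Blocked R(h'; L', M))`
  for `0 ≤ h ≤ h'`, `L' ≤ L` (a bottom–top crossing of the taller, narrower box, stopped at its
  first visit to height `h`, crosses the shorter, wider one);
* `stub_shortbox` (OPEN, the second open leaf; fixed-aspect RSW-type comparison in `d = 3`):
  one monotone `g_sb > 0` on `(0,∞)` with `g_sb(P(Blocked R(4m; 4m, M))) ≤ P(Blocked R(3m; 4m, M))`
  for `m ≥ 1`, `M ∈ [4m, 24m]` at `p_c(ℤ³)` — lowering the height of the box from `4m` to `3m` over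
  the base `4m × M` costs at most `g_sb`. It is needed ONLY for `L ∈ [4m, 5m)` (slab thickness
  `L − m < 4m`); for `L ≥ 5m` the chain `P(Blocked R(4m;L,M)) ≤ P(Blocked R(4m;4m,M)) ≤
  P(Blocked R(L−m;4m,M)) ≤ P(Diag_a)` uses `stub_boxMono` twice and `g₂ = id`.

`stub_balancing` is unchanged (OPEN, the hardest stub, held by the lead).

STATUS after cycle 1 (lead, 2026-08-17 ~09:30Z). CLOSED: `stub_boxMono` (p147565), `stub_diagReduce`
(p150194) — imported below, their `sorry`s replaced. OPEN: `stub_balancing`, `stub_shortbox` (the only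
two `sorry`s left; both OPEN-PROBLEM class = 3-D RSW in the hard direction). Certified around them
(namespace `…Theorems.TiltComparison`, all `--supports 6393`): `tiltComparison_of_balancing_of_shortbox`
(the two open leaves ⟹ crux; Reductions p151087), `stub_balancing_of_tiltComparison` (crux ⟹ balancing;
FromXB), `stub_shortbox_of_tiltComparison_of_cubeBlockingSeed` (crux ∧ 1141 ⟹ shortbox; p147810),
`stub_balancing_of_heightHalving` / `stub_shortbox_of_heightHalving` / `tiltComparison_of_heightHalving`
(ONE height-halving comparison `HH: g(P(Blocked R(4m;L,M))) ≤ P(Blocked R(2m;L,M))` on the family ⟹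
both leaves ⟹ crux; p150436, p151087), `tiltComparison_of_critAnnulusNonCrossing` (0846 ⟹ HH ⟹ crux;
FromXB) and `critAnnulusNonCrossing_iff_shortbox_and_cubeBlockingSeed` (p147810); with the route's
proved 6393 ∧ 1141 ⟹ 0846: `CritAnnulusNonCrossing (0846) ⟺ TiltComparison (6393) ∧ CubeBlockingSeed (1141)`.
Diagnosis (why the two leaves resist): EXTENT INVARIANT — every lower bound for `High_a`/`Low_a`/`Diag_a`
through the seal calculus needs a seal of `x₀`-extent `< 4m` (p150436/p150194), and no operation of the
calculus {Harris, union lemma, restriction, raise, symmetry, clipping} decreases the sealed extent; the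
missing input is an extent-REDUCING comparison (HH / `stub_shortbox`) = Benjamini–Kalai 2018 p.71.
STUCK goals for the disprover (`-- Targets`): `stub_balancing`, `stub_shortbox` as registered; the lead
suspects neither is false (both follow from 0846); `disprover-wanted:` a `_false_without_` analysis of
`HH` (is height halving at p_c consistent with d > 6 / η = 0 scaling?).

Disproof used: none filed for this crux (`ledger crux ls stmt-CriticalPhenomena-6393`: no
workfiles, 2026-08-17; no `Theorems/TiltComparison/Negative/*`). Negatives index: the only entry
touching this route is `not_TiltGluing` (stmt-6394, refuted-MISSTATED: non-lattice open pairs;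
repaired as `TiltGluingLattice`, PROVED) — irrelevant to the stubs, which are statements about
`bondPercolation (zdGraph 3) (criticalProbI 3)`-probabilities only (non-lattice pairs are a.s.
closed). Evidence on the item: MC at `p_c` (jobs j003359/j003906): `max_a P(Tilt_a)/P(Blocked)
≈ 0.40` on cubes of side 8/12/16 (plateau), `≈ 0.17` on flat `4m × 8m × 8m` boxes — consistent
with both stubs. No new route, no restatement of the crux.
-/

noncomputable section

open MeasureTheory
open Literature.Probability.Percolation Literature.Probability.LatticeModels

namespace Summit.CriticalPhenomena.PercolationContinuityZ3.Cruxes.TiltComparison.Birth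

/-! ## The two registered stubs: precise `Prop`s `Stubs.stub_*` + sorried theorems `stub_*` -/

namespace Stubs

/-- **Stub `Prop` 1 (`TiltBalancing`, OPEN, the hardest stub)** — at `p_c(ℤ³)`, on the shape
family `R(4m; L, M)`, `L, M ∈ [4m, 24m]`, there is a COMMON level `a` at which both one-sided
tilted-blocker events `High_a` (no open path in `R` from `{x₀=0} ∪ {x₁=L, x₀<a}` to `{x₀=4m}`) and
`Low_a` (no open path in `R` from `{x₀=0}` to `{x₀=4m} ∪ {x₁=m, x₀≥a}`) have probability
`≥ g₁(P(Blocked R))`, one monotone `g₁ > 0` on `(0,∞)`. -/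
def stub_balancing : Prop :=
  ∃ g : ℝ → ℝ, Monotone g ∧ (∀ s, 0 < s → 0 < g s) ∧ ∀ m L M : ℕ, 1 ≤ m → 4 * m ≤ L →
    L ≤ 24 * m → 4 * m ≤ M → M ≤ 24 * m → ∃ a : ℕ,
      g ((bondPercolation (zdGraph 3) (criticalProbI 3)).real
          {ω | ¬ ∃ x ∈ Finset.Icc (0 : Site 3) ![4 * (m : ℤ), L, M],
            ∃ y ∈ Finset.Icc (0 : Site 3) ![4 * (m : ℤ), L, M],
              x 0 = 0 ∧ y 0 = 4 * m ∧
                ω ∈ openConnIn ↑(Finset.Icc (0 : Site 3) ![4 * (m : ℤ), L, M]) x y}) ≤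
        (bondPercolation (zdGraph 3) (criticalProbI 3)).real
          {ω | ¬ ∃ x ∈ Finset.Icc (0 : Site 3) ![4 * (m : ℤ), L, M],
            ∃ y ∈ Finset.Icc (0 : Site 3) ![4 * (m : ℤ), L, M],
              (x 0 = 0 ∨ (x 1 = L ∧ x 0 < a)) ∧ y 0 = 4 * m ∧
                ω ∈ openConnIn ↑(Finset.Icc (0 : Site 3) ![4 * (m : ℤ), L, M]) x y} ∧
      g ((bondPercolation (zdGraph 3) (criticalProbI 3)).real
          {ω | ¬ ∃ x ∈ Finset.Icc (0 : Site 3) ![4 * (m : ℤ), L, M],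
            ∃ y ∈ Finset.Icc (0 : Site 3) ![4 * (m : ℤ), L, M],
              x 0 = 0 ∧ y 0 = 4 * m ∧
                ω ∈ openConnIn ↑(Finset.Icc (0 : Site 3) ![4 * (m : ℤ), L, M]) x y}) ≤
        (bondPercolation (zdGraph 3) (criticalProbI 3)).real
          {ω | ¬ ∃ x ∈ Finset.Icc (0 : Site 3) ![4 * (m : ℤ), L, M],
            ∃ y ∈ Finset.Icc (0 : Site 3) ![4 * (m : ℤ), L, M],
              x 0 = 0 ∧ (y 0 = 4 * m ∨ (y 1 = m ∧ (a : ℤ) ≤ y 0)) ∧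
                ω ∈ openConnIn ↑(Finset.Icc (0 : Site 3) ![4 * (m : ℤ), L, M]) x y}

/-- **Stub `Prop` 2 (`TiltDiagonal`, the Harris-explicit `TiltMerging`)** — at `p_c(ℤ³)`, on the
same shape family and for EVERY level `a`, the diagonal event `Diag_a` (no open path in `R` from
the low right patch `{x₁=L, x₀<a}` to the high mid-plane part `{x₁=m, x₀≥a}`) has probability
`≥ g₂(P(Blocked R))`, one monotone `g₂ > 0` on `(0,∞)`. (Free with `g₂ = id` for `L ≥ 5m`; the
content is the short-box comparison for `L ∈ [4m, 5m)`.) -/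
def stub_diagonal : Prop :=
  ∃ g : ℝ → ℝ, Monotone g ∧ (∀ s, 0 < s → 0 < g s) ∧ ∀ m L M a : ℕ, 1 ≤ m → 4 * m ≤ L →
    L ≤ 24 * m → 4 * m ≤ M → M ≤ 24 * m →
      g ((bondPercolation (zdGraph 3) (criticalProbI 3)).real
          {ω | ¬ ∃ x ∈ Finset.Icc (0 : Site 3) ![4 * (m : ℤ), L, M],
            ∃ y ∈ Finset.Icc (0 : Site 3) ![4 * (m : ℤ), L, M],
              x 0 = 0 ∧ y 0 = 4 * m ∧
                ω ∈ openConnIn ↑(Finset.Icc (0 : Site 3) ![4 * (m : ℤ), L, M]) x y}) ≤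
        (bondPercolation (zdGraph 3) (criticalProbI 3)).real
          {ω | ¬ ∃ x ∈ Finset.Icc (0 : Site 3) ![4 * (m : ℤ), L, M],
            ∃ y ∈ Finset.Icc (0 : Site 3) ![4 * (m : ℤ), L, M],
              (x 1 = L ∧ x 0 < a) ∧ (y 1 = m ∧ (a : ℤ) ≤ y 0) ∧
                ω ∈ openConnIn ↑(Finset.Icc (0 : Site 3) ![4 * (m : ℤ), L, M]) x y}

/-- **Stub `Prop` 3 (`DiagReduce`, registered, provable now)** — for every `p`, every box
`R(4m; L, M)` with `m ≤ L` and every level `a`: the diagonal event `Diag_a` (no open path inside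
`R` from `{x₁ = L, x₀ < a}` to `{x₁ = m, x₀ ≥ a}`) is at least as likely as the blocking of the
short box `R(L−m; 4m, M) = Icc 0 (L−m, 4m, M)` between its faces `x₀ = 0` and `x₀ = L−m`
(an `RL_a → MH_a` path clipped at the plane `x₁ = m` crosses the slab `[0,4m] × [m,L] × [0,M]`
in the `x₁`-direction; lattice isometry `(x₀,x₁,x₂) ↦ (x₁ − m, x₀, x₂)`). [folklore] -/
def stub_diagReduce : Prop :=
  ∀ (p : unitInterval) (m L M a : ℕ), m ≤ L →
    (bondPercolation (zdGraph 3) p).real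
        {ω | ¬ ∃ x ∈ Finset.Icc (0 : Site 3) ![(L : ℤ) - m, 4 * m, M],
          ∃ y ∈ Finset.Icc (0 : Site 3) ![(L : ℤ) - m, 4 * m, M],
            x 0 = 0 ∧ y 0 = (L : ℤ) - m ∧
              ω ∈ openConnIn ↑(Finset.Icc (0 : Site 3) ![(L : ℤ) - m, 4 * m, M]) x y} ≤
      (bondPercolation (zdGraph 3) p).real
        {ω | ¬ ∃ x ∈ Finset.Icc (0 : Site 3) ![4 * (m : ℤ), L, M],
          ∃ y ∈ Finset.Icc (0 : Site 3) ![4 * (m : ℤ), L, M],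
            (x 1 = L ∧ x 0 < a) ∧ (y 1 = m ∧ (a : ℤ) ≤ y 0) ∧
              ω ∈ openConnIn ↑(Finset.Icc (0 : Site 3) ![4 * (m : ℤ), L, M]) x y}

/-- **Stub `Prop` 4 (`BoxMono`, registered, provable now)** — for every `p` and integer box
parameters `0 ≤ h ≤ h'`, `L' ≤ L`, any `M`: blocking `R(h; L, M)` between `x₀ = 0` and `x₀ = h`
is at most as likely as blocking the taller, narrower `R(h'; L', M)` between `x₀ = 0` and
`x₀ = h'` (a bottom–top open crossing of `R(h'; L', M)`, stopped at its first visit to the level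
`x₀ = h`, is a bottom–top crossing of `R(h; L, M)`). [folklore] -/
def stub_boxMono : Prop :=
  ∀ (p : unitInterval) (h h' L L' M : ℤ), 0 ≤ h → h ≤ h' → L' ≤ L →
    (bondPercolation (zdGraph 3) p).real
        {ω | ¬ ∃ x ∈ Finset.Icc (0 : Site 3) ![h, L, M], ∃ y ∈ Finset.Icc (0 : Site 3) ![h, L, M],
          x 0 = 0 ∧ y 0 = h ∧ ω ∈ openConnIn ↑(Finset.Icc (0 : Site 3) ![h, L, M]) x y} ≤
      (bondPercolation (zdGraph 3) p).real
        {ω | ¬ ∃ x ∈ Finset.Icc (0 : Site 3) ![h', L', M], ∃ y ∈ Finset.Icc (0 : Site 3) ![h', L', M],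
          x 0 = 0 ∧ y 0 = h' ∧ ω ∈ openConnIn ↑(Finset.Icc (0 : Site 3) ![h', L', M]) x y}

/-- **Stub `Prop` 5 (`ShortBox`, registered, OPEN — fixed-aspect RSW-type comparison in `d = 3`)**
— at `p_c(ℤ³)`: one monotone `g > 0` on `(0,∞)` with
`g(P(Blocked R(4m; 4m, M))) ≤ P(Blocked R(3m; 4m, M))` for all `m ≥ 1`, `M ∈ [4m, 24m]`:
lowering the height of the box from `4m` to `3m` over the base `[0,4m] × [0,M]` costs at most `g`.
Needed only for the boxes `R(4m; L, M)` with `L ∈ [4m, 5m)` of the crux family. Planar analogue: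
RSW at aspect ratio `4/3` (Tassion 2016 L2.2); no 3-D tool known (BenjaminiKalai2018 p.71). -/
def stub_shortbox : Prop :=
  ∃ g : ℝ → ℝ, Monotone g ∧ (∀ s, 0 < s → 0 < g s) ∧ ∀ m M : ℕ, 1 ≤ m → 4 * m ≤ M →
    M ≤ 24 * m →
      g ((bondPercolation (zdGraph 3) (criticalProbI 3)).real
          {ω | ¬ ∃ x ∈ Finset.Icc (0 : Site 3) ![4 * (m : ℤ), 4 * m, M],
            ∃ y ∈ Finset.Icc (0 : Site 3) ![4 * (m : ℤ), 4 * m, M],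
              x 0 = 0 ∧ y 0 = 4 * m ∧
                ω ∈ openConnIn ↑(Finset.Icc (0 : Site 3) ![4 * (m : ℤ), 4 * m, M]) x y}) ≤
        (bondPercolation (zdGraph 3) (criticalProbI 3)).real
          {ω | ¬ ∃ x ∈ Finset.Icc (0 : Site 3) ![3 * (m : ℤ), 4 * m, M],
            ∃ y ∈ Finset.Icc (0 : Site 3) ![3 * (m : ℤ), 4 * m, M],
              x 0 = 0 ∧ y 0 = 3 * m ∧
                ω ∈ openConnIn ↑(Finset.Icc (0 : Site 3) ![3 * (m : ℤ), 4 * m, M]) x y}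

end Stubs

/-- **stub 1 (registered) = `Stubs.stub_balancing` spelled out** — `TiltBalancing` at `p_c(ℤ³)`:
one monotone `g > 0` on `(0,∞)` such that every box `R(4m; L, M)` of the family carries a common
level `a` with `P(High_a) ≥ g(P(Blocked))` and `P(Low_a) ≥ g(P(Blocked))`. OPEN (the 3-D
replacement of Tassion 2016 L2.1; no pigeonhole over landing points in `d = 3`); size: open-problem. -/
theorem stub_balancing :
    ∃ g : ℝ → ℝ, Monotone g ∧ (∀ s, 0 < s → 0 < g s) ∧ ∀ m L M : ℕ, 1 ≤ m → 4 * m ≤ L →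
      L ≤ 24 * m → 4 * m ≤ M → M ≤ 24 * m → ∃ a : ℕ,
        g ((bondPercolation (zdGraph 3) (criticalProbI 3)).real
            {ω | ¬ ∃ x ∈ Finset.Icc (0 : Site 3) ![4 * (m : ℤ), L, M],
              ∃ y ∈ Finset.Icc (0 : Site 3) ![4 * (m : ℤ), L, M],
                x 0 = 0 ∧ y 0 = 4 * m ∧
                  ω ∈ openConnIn ↑(Finset.Icc (0 : Site 3) ![4 * (m : ℤ), L, M]) x y}) ≤
          (bondPercolation (zdGraph 3) (criticalProbI 3)).real
            {ω | ¬ ∃ x ∈ Finset.Icc (0 : Site 3) ![4 * (m : ℤ), L, M],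
              ∃ y ∈ Finset.Icc (0 : Site 3) ![4 * (m : ℤ), L, M],
                (x 0 = 0 ∨ (x 1 = L ∧ x 0 < a)) ∧ y 0 = 4 * m ∧
                  ω ∈ openConnIn ↑(Finset.Icc (0 : Site 3) ![4 * (m : ℤ), L, M]) x y} ∧
        g ((bondPercolation (zdGraph 3) (criticalProbI 3)).real
            {ω | ¬ ∃ x ∈ Finset.Icc (0 : Site 3) ![4 * (m : ℤ), L, M],
              ∃ y ∈ Finset.Icc (0 : Site 3) ![4 * (m : ℤ), L, M],
                x 0 = 0 ∧ y 0 = 4 * m ∧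
                  ω ∈ openConnIn ↑(Finset.Icc (0 : Site 3) ![4 * (m : ℤ), L, M]) x y}) ≤
          (bondPercolation (zdGraph 3) (criticalProbI 3)).real
            {ω | ¬ ∃ x ∈ Finset.Icc (0 : Site 3) ![4 * (m : ℤ), L, M],
              ∃ y ∈ Finset.Icc (0 : Site 3) ![4 * (m : ℤ), L, M],
                x 0 = 0 ∧ (y 0 = 4 * m ∨ (y 1 = m ∧ (a : ℤ) ≤ y 0)) ∧
                  ω ∈ openConnIn ↑(Finset.Icc (0 : Site 3) ![4 * (m : ℤ), L, M]) x y} := by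
  sorry

/-- **stub 3 (registered, CLOSED p150194) = `Stubs.stub_diagReduce` spelled out** — for every `p`,
`m ≤ L`, every `M` and every level `a`: `P_p(Blocked R(L−m; 4m, M)) ≤ P_p(Diag_a R(4m; L, M))`
(clip at the plane `x₁ = m`, lattice isometry `(x₀,x₁,x₂) ↦ (x₁ − m, x₀, x₂)`). -/
theorem stub_diagReduce :
    ∀ (p : unitInterval) (m L M a : ℕ), m ≤ L →
      (bondPercolation (zdGraph 3) p).real
          {ω | ¬ ∃ x ∈ Finset.Icc (0 : Site 3) ![(L : ℤ) - m, 4 * m, M],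
            ∃ y ∈ Finset.Icc (0 : Site 3) ![(L : ℤ) - m, 4 * m, M],
              x 0 = 0 ∧ y 0 = (L : ℤ) - m ∧
                ω ∈ openConnIn ↑(Finset.Icc (0 : Site 3) ![(L : ℤ) - m, 4 * m, M]) x y} ≤
        (bondPercolation (zdGraph 3) p).real
          {ω | ¬ ∃ x ∈ Finset.Icc (0 : Site 3) ![4 * (m : ℤ), L, M],
            ∃ y ∈ Finset.Icc (0 : Site 3) ![4 * (m : ℤ), L, M],
              (x 1 = L ∧ x 0 < a) ∧ (y 1 = m ∧ (a : ℤ) ≤ y 0) ∧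
                ω ∈ openConnIn ↑(Finset.Icc (0 : Site 3) ![4 * (m : ℤ), L, M]) x y} :=
  -- LANDED (wave 1, p150194): Theorems/PercTiltedBlockersTiltComparisonStubDiagReduce.lean
  Summit.CriticalPhenomena.PercolationContinuityZ3.Theorems.TiltComparison.stub_diagReduce

/-- **stub 4 (registered, CLOSED p147565) = `Stubs.stub_boxMono` spelled out** — for every `p` and
integers `0 ≤ h ≤ h'`, `L' ≤ L`, any `M`: `P_p(Blocked R(h; L, M)) ≤ P_p(Blocked R(h'; L', M))`
(bottom–top blocking is easier in a taller, narrower box; clip at the level `x₀ = h`). -/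
theorem stub_boxMono :
    ∀ (p : unitInterval) (h h' L L' M : ℤ), 0 ≤ h → h ≤ h' → L' ≤ L →
      (bondPercolation (zdGraph 3) p).real
          {ω | ¬ ∃ x ∈ Finset.Icc (0 : Site 3) ![h, L, M], ∃ y ∈ Finset.Icc (0 : Site 3) ![h, L, M],
            x 0 = 0 ∧ y 0 = h ∧ ω ∈ openConnIn ↑(Finset.Icc (0 : Site 3) ![h, L, M]) x y} ≤
        (bondPercolation (zdGraph 3) p).real
          {ω | ¬ ∃ x ∈ Finset.Icc (0 : Site 3) ![h', L', M],
            ∃ y ∈ Finset.Icc (0 : Site 3) ![h', L', M],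
              x 0 = 0 ∧ y 0 = h' ∧ ω ∈ openConnIn ↑(Finset.Icc (0 : Site 3) ![h', L', M]) x y} :=
  -- LANDED (wave 1, p147565): Theorems/PercTiltedBlockersTiltComparisonStubBoxMono.lean
  Summit.CriticalPhenomena.PercolationContinuityZ3.Theorems.TiltComparison.stub_boxMono

/-- **stub 5 (registered) = `Stubs.stub_shortbox` spelled out** — OPEN (fixed-aspect RSW-type
comparison at `p_c(ℤ³)`): one monotone `g > 0` on `(0,∞)` with
`g(P(Blocked R(4m; 4m, M))) ≤ P(Blocked R(3m; 4m, M))` for `m ≥ 1`, `M ∈ [4m, 24m]`; size: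
open-problem (needed only for the boxes with `L ∈ [4m, 5m)`). -/
theorem stub_shortbox :
    ∃ g : ℝ → ℝ, Monotone g ∧ (∀ s, 0 < s → 0 < g s) ∧ ∀ m M : ℕ, 1 ≤ m → 4 * m ≤ M →
      M ≤ 24 * m →
        g ((bondPercolation (zdGraph 3) (criticalProbI 3)).real
            {ω | ¬ ∃ x ∈ Finset.Icc (0 : Site 3) ![4 * (m : ℤ), 4 * m, M],
              ∃ y ∈ Finset.Icc (0 : Site 3) ![4 * (m : ℤ), 4 * m, M],
                x 0 = 0 ∧ y 0 = 4 * m ∧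
                  ω ∈ openConnIn ↑(Finset.Icc (0 : Site 3) ![4 * (m : ℤ), 4 * m, M]) x y}) ≤
          (bondPercolation (zdGraph 3) (criticalProbI 3)).real
            {ω | ¬ ∃ x ∈ Finset.Icc (0 : Site 3) ![3 * (m : ℤ), 4 * m, M],
              ∃ y ∈ Finset.Icc (0 : Site 3) ![3 * (m : ℤ), 4 * m, M],
                x 0 = 0 ∧ y 0 = 3 * m ∧
                  ω ∈ openConnIn ↑(Finset.Icc (0 : Site 3) ![3 * (m : ℤ), 4 * m, M]) x y} := by
  sorry

/-! ## Derived intermediate (proved): the diagonal comparison from stubs 3–5 -/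

/-- **`Stubs.stub_diagonal` from `stub_diagReduce`, `stub_boxMono`, `stub_shortbox`** (PROVED,
order arithmetic). Witness `g₂ s := min s (g_sb s)`. For a box of the family and a level `a`:
`P(Diag_a) ≥ P(Blocked R(L−m; 4m, M))` (reduce); if `5m ≤ L` then `L − m ≥ 4m` and
`P(Blocked R(L−m;4m,M)) ≥ P(Blocked R(4m;4m,M)) ≥ P(Blocked R(4m;L,M)) ≥ g₂(·)` (box monotonicity
twice); if `L < 5m` then `L − m ≥ 3m` and `P(Blocked R(L−m;4m,M)) ≥ P(Blocked R(3m;4m,M)) ≥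
g_sb(P(Blocked R(4m;4m,M))) ≥ g_sb(P(Blocked R(4m;L,M))) ≥ g₂(·)` (monotonicity, short box,
`g_sb` monotone). -/
theorem stub_diagonal_of (hR : Stubs.stub_diagReduce) (hM : Stubs.stub_boxMono)
    (hS : Stubs.stub_shortbox) : Stubs.stub_diagonal := by
  unfold Stubs.stub_diagReduce at hR
  unfold Stubs.stub_boxMono at hM
  unfold Stubs.stub_shortbox at hS
  unfold Stubs.stub_diagonal
  obtain ⟨g, hg, hg0, H⟩ := hS
  refine ⟨fun s => min s (g s), monotone_id.min hg, fun s hs => lt_min hs (hg0 s hs), ?_⟩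
  intro m L M a hm hL hL' hMlo hMhi
  have hD := hR (criticalProbI 3) m L M a (by omega)
  have h1 := hM (criticalProbI 3) (4 * (m : ℤ)) (4 * (m : ℤ)) (L : ℤ) (4 * (m : ℤ)) (M : ℤ)
    (by positivity) le_rfl (by exact_mod_cast hL)
  by_cases h5 : 5 * m ≤ L
  · have h2 := hM (criticalProbI 3) (4 * (m : ℤ)) ((L : ℤ) - m) (4 * (m : ℤ)) (4 * (m : ℤ)) (M : ℤ)
      (by positivity) (by omega) le_rfl
    exact (min_le_left _ _).trans (h1.trans (h2.trans hD))
  · have h3 := hM (criticalProbI 3) (3 * (m : ℤ)) ((L : ℤ) - m) (4 * (m : ℤ)) (4 * (m : ℤ)) (M : ℤ)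
      (by positivity) (by omega) le_rfl
    have h4 := H m M hm hMlo hMhi
    exact (min_le_right _ _).trans ((hg h1).trans (h4.trans (h3.trans hD)))

/-! ## Tools for the composition (all proved): the tilt event factors, Harris–FKG twice -/

/-- The generic "no open path inside the finite box `R` from `{x ∈ R | Ps x}` to `{y ∈ R | Qs y}`"
event, in the exact shape of the route's decls. -/
def noPath (R : Finset (Site 3)) (Ps Qs : Site 3 → Prop) : Set (BondConfig (Site 3)) :=
  {ω | ¬ ∃ x ∈ R, ∃ y ∈ R, Ps x ∧ Qs y ∧ ω ∈ openConnIn (↑R : Set (Site 3)) x y}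

theorem noPath_eq_compl (R : Finset (Site 3)) (Ps Qs : Site 3 → Prop) :
    noPath R Ps Qs =
      (openCrossing (↑R : Set (Site 3)) {x | x ∈ R ∧ Ps x} {y | y ∈ R ∧ Qs y})ᶜ := by
  ext ω
  simp only [noPath, Set.mem_setOf_eq, Set.mem_compl_iff, mem_openCrossing_iff]
  exact Iff.not ⟨fun ⟨x, hx, y, hy, hP, hQ, hc⟩ => ⟨x, ⟨hx, hP⟩, y, ⟨hy, hQ⟩, hc⟩,
    fun ⟨x, ⟨hx, hP⟩, y, ⟨hy, hQ⟩, hc⟩ => ⟨x, hx, y, hy, hP, hQ, hc⟩⟩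

/-- `noPath` events are decreasing. -/
theorem isLowerSet_noPath (R : Finset (Site 3)) (Ps Qs : Site 3 → Prop) :
    IsLowerSet (noPath R Ps Qs) := by
  rw [noPath_eq_compl]; exact (isUpperSet_openCrossing _ _ _).compl

/-- `noPath` events of a finite box are measurable. -/
theorem measurableSet_noPath (R : Finset (Site 3)) (Ps Qs : Site 3 → Prop) :
    MeasurableSet (noPath R Ps Qs) := by
  rw [noPath_eq_compl]; exact (measurableSet_openCrossing _ _ _).compl

/-- Harris–FKG for three decreasing measurable events, followed by monotonicity of measure. -/
theorem real_mul_mul_le (p : unitInterval) {A B C D : Set (BondConfig (Site 3))}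
    (hA : IsLowerSet A) (hB : IsLowerSet B) (hC : IsLowerSet C)
    (hAm : MeasurableSet A) (hBm : MeasurableSet B) (hCm : MeasurableSet C)
    (hsub : A ∩ B ∩ C ⊆ D) :
    (bondPercolation (zdGraph 3) p).real A * (bondPercolation (zdGraph 3) p).real B *
        (bondPercolation (zdGraph 3) p).real C ≤ (bondPercolation (zdGraph 3) p).real D := by
  have h1 := harris_fkg_lower (zdGraph 3) p hA hB hAm hBm
  have h2 := harris_fkg_lower (zdGraph 3) p (hA.inter hB) hC (hAm.inter hBm) hCm
  have h3 : (bondPercolation (zdGraph 3) p).real (A ∩ B ∩ C) ≤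
      (bondPercolation (zdGraph 3) p).real D := measureReal_mono hsub
  calc (bondPercolation (zdGraph 3) p).real A * (bondPercolation (zdGraph 3) p).real B *
        (bondPercolation (zdGraph 3) p).real C
      ≤ (bondPercolation (zdGraph 3) p).real (A ∩ B) * (bondPercolation (zdGraph 3) p).real C :=
        mul_le_mul_of_nonneg_right h1 measureReal_nonneg
    _ ≤ (bondPercolation (zdGraph 3) p).real (A ∩ B ∩ C) := h2
    _ ≤ (bondPercolation (zdGraph 3) p).real D := h3

/-- The factorisation `High ∩ Low ∩ Diag ⊆ Tilt` (pure logic on the endpoint predicates). -/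
theorem inter_subset_noPath_or (R : Finset (Site 3)) (P₁ P₂ Q₁ Q₂ : Site 3 → Prop) :
    noPath R (fun x => P₁ x ∨ P₂ x) Q₁ ∩ noPath R P₁ (fun y => Q₁ y ∨ Q₂ y) ∩ noPath R P₂ Q₂ ⊆
      noPath R (fun x => P₁ x ∨ P₂ x) (fun y => Q₁ y ∨ Q₂ y) := by
  rintro ω ⟨⟨hH, hL⟩, hD⟩ ⟨x, hx, y, hy, hP, hQ, hc⟩
  rcases hQ with hQ | hQ
  · exact hH ⟨x, hx, y, hy, hP, hQ, hc⟩
  · rcases hP with hP | hP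
    · exact hL ⟨x, hx, y, hy, hP, Or.inr hQ, hc⟩
    · exact hD ⟨x, hx, y, hy, hP, hQ, hc⟩

/-- `P(High) · P(Low) · P(Diag) ≤ P(Tilt)` for any box and any endpoint predicates, every `p`. -/
theorem tilt_lower_bound (p : unitInterval) (R : Finset (Site 3)) (P₁ P₂ Q₁ Q₂ : Site 3 → Prop) :
    (bondPercolation (zdGraph 3) p).real (noPath R (fun x => P₁ x ∨ P₂ x) Q₁) *
        (bondPercolation (zdGraph 3) p).real (noPath R P₁ (fun y => Q₁ y ∨ Q₂ y)) *
        (bondPercolation (zdGraph 3) p).real (noPath R P₂ Q₂) ≤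
      (bondPercolation (zdGraph 3) p).real
        (noPath R (fun x => P₁ x ∨ P₂ x) (fun y => Q₁ y ∨ Q₂ y)) :=
  real_mul_mul_le p (isLowerSet_noPath _ _ _) (isLowerSet_noPath _ _ _) (isLowerSet_noPath _ _ _)
    (measurableSet_noPath _ _ _) (measurableSet_noPath _ _ _) (measurableSet_noPath _ _ _)
    (inter_subset_noPath_or R P₁ P₂ Q₁ Q₂)

/-- The arithmetic of the composition. -/
theorem sq_mul_le_of_le {u w H Lo D T : ℝ} (hu : 0 ≤ u) (hw : 0 ≤ w) (hH : u ≤ H) (hL : u ≤ Lo)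
    (hD : w ≤ D) (hkey : H * Lo * D ≤ T) : u ^ 2 * w ≤ T := by
  have h0H : 0 ≤ H := hu.trans hH
  have h0L : 0 ≤ Lo := hu.trans hL
  have h1 : u * u ≤ H * Lo := mul_le_mul hH hL hu h0H
  have h2 : u * u * w ≤ H * Lo * D := mul_le_mul h1 hD hw (mul_nonneg h0H h0L)
  rw [sq]; exact h2.trans hkey

/-! ## The composition (proved): the two stubs imply the crux BY NAME -/

/-- **`TiltComparison` from the two stubs** (hypotheses = the declared stub `Prop`s by name;
conclusion = the route decl `PercTiltedBlockers.TiltComparison` by name; no `sorry`).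
Witness: `g s := (max (g₁ s) 0) ^ 2 * max (g₂ s) 0`; level `a` from stub 1; then Harris twice. -/
theorem TiltComparison_of (h1 : Stubs.stub_balancing) (h2 : Stubs.stub_diagonal) :
    Summit.CriticalPhenomena.PercolationContinuityZ3.Theses.PercTiltedBlockers.TiltComparison := by
  unfold Stubs.stub_balancing at h1
  unfold Stubs.stub_diagonal at h2
  obtain ⟨g₁, hg₁, hg₁0, H1⟩ := h1
  obtain ⟨g₂, hg₂, hg₂0, H2⟩ := h2
  refine ⟨fun s => (max (g₁ s) 0) ^ 2 * max (g₂ s) 0, ?_, ?_, ?_⟩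
  · -- monotone: product of nonnegative monotone functions
    intro s t hst
    have a1 : max (g₁ s) 0 ≤ max (g₁ t) 0 := max_le_max (hg₁ hst) le_rfl
    have a2 : max (g₂ s) 0 ≤ max (g₂ t) 0 := max_le_max (hg₂ hst) le_rfl
    have b1 : (0 : ℝ) ≤ max (g₁ s) 0 := le_max_right _ _
    have b2 : (0 : ℝ) ≤ max (g₂ s) 0 := le_max_right _ _
    exact mul_le_mul (pow_le_pow_left₀ b1 a1 2) a2 b2 (sq_nonneg _)
  · -- positive on (0, ∞)
    intro s hs
    have c1 : (0 : ℝ) < max (g₁ s) 0 := lt_max_of_lt_left (hg₁0 s hs)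
    have c2 : (0 : ℝ) < max (g₂ s) 0 := lt_max_of_lt_left (hg₂0 s hs)
    exact mul_pos (pow_pos c1 2) c2
  · -- the comparison at the balanced level
    intro m L M hm hL hL' hM hM'
    obtain ⟨a, haH, haL⟩ := H1 m L M hm hL hL' hM hM'
    have haD := H2 m L M a hm hL hL' hM hM'
    refine ⟨a, ?_⟩
    have key := tilt_lower_bound (criticalProbI 3) (Finset.Icc (0 : Site 3) ![4 * (m : ℤ), L, M])
      (fun x => x 0 = 0) (fun x => x 1 = L ∧ x 0 < a)
      (fun y => y 0 = 4 * m) (fun y => y 1 = m ∧ (a : ℤ) ≤ y 0)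
    exact sq_mul_le_of_le (le_max_right _ _) (le_max_right _ _) (max_le haH measureReal_nonneg)
      (max_le haL measureReal_nonneg) (max_le haD measureReal_nonneg) key

/-- **The skeleton IS the crux proof** (D-0027 §3.3): `TiltComparison` from the four registered
stubs; sorry-free as soon as `stub_balancing`, `stub_diagReduce`, `stub_boxMono` and
`stub_shortbox` are discharged (`stub_diagonal_of` and `TiltComparison_of` are proved). -/
theorem TiltComparison_proof :
    Summit.CriticalPhenomena.PercolationContinuityZ3.Theses.PercTiltedBlockers.TiltComparison :=
  TiltComparison_of stub_balancing (stub_diagonal_of stub_diagReduce stub_boxMono stub_shortbox)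

end Summit.CriticalPhenomena.PercolationContinuityZ3.Cruxes.TiltComparison.Birth

end
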